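import Summits.BirchSwinnertonDyer.BirchSwinnertonDyer.Theorems.PrintCf2RamifiedOffTYZMoverBlockFormSixInvolutions
import HarnessLib

/-!
# Crux `PrintCf2.RamifiedOffTYZOfFacts` (stmt-BirchSwinnertonDyer-20509), line `offtyz-v7`, LEAD cycle 14 (cruxlead-20509 g13):
# THE REGIME-FREE BLOCK FORM ON A BLOCK `d ≡ 6 (mod 8)`, PART III — `χ_d = kerSum(N_d)·x_d` WITHOUT `g(d)` odd and WITHOUT `#ker N_d = 2`

THEOREMS ONLY (no `def`, no named fact, no `sorry`), `--supports stmt-BirchSwinnertonDyer-20509`.  Sequel of `…MoverBlockFormSixKernel` /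
`…MoverBlockFormSixInvolutions`.

For a block `d = 2q₁⋯q_m ≡ 6 (mod 8)` of a square-free `n` with its CM-point display, the lift `θ` of `σ_{1+ϖ}`, a ring class dictionary `ρ` onto
a finite abelian group `G` ((RC1)–(RC3) as hypotheses `hρ1 hρ2 hρ3`; `G = Pic(𝒪₄)` for the consumer) and the conductor-`4` Frobenius elements
`φ_j ∈ Gal(ℍ′_n/K_d)` of the `q_j` ((F1)–(F3)):
* §1 CASE A, `#ker N_d = 2` (`exists_sqChi_of_card_ker_eq_two`): `(G²)[2] = {1, ρ(σ)}` (previous file) and `#G² = 2g(d)`, so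
  `FourRankOne.exists_pow_eq_of_forall_sq_eq_one` yields `y ∈ G²` with `y^{g(d)} = ρ(σ)`, i.e. an automorphism `a` with `χ_d(a) = 1` — NO `g(d)` odd.
* §2 CASE B, `#ker N_d ≠ 2` (`sqChi_not_mem_of_card_ker_ne_two`): a relation `Σ_{j∈U} N_j = 0`, `U ≠ ∅`, makes `e = ∏_{j∈U} ρ(φ_j)` a square
  involution; if it is `≠ 1, ρ(σ)` (hypothesis `hval` — for `Pic(𝒪₄)` the class values (F4): `∏_{j∈U}[𝔭_{q_j}] ≠ 1` in `Cl(𝒪_{K_d})`) then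
  `FourRankOne.eq_one_or_eq_of_pow_eq` forbids `χ_d(a) = 1` for every `a` (g12's transfer lemma, in `G`).
* §3 **THE BLOCK FORM** (`sqMotion_eq_kerSum_dotProduct_bits_six_all`): `χ_d(g) = Σ_c kerSum(N_d)_c · x_c(g)` for EVERY `g ∈ Gal(ℍ′_n/K_d)` — g8's
  `sqMotion_eq_kerSum_dotProduct_bits_six` with the genus-regime hypotheses `Odd (gK d)`, `#ker N_d = 2` REMOVED (in case B both sides vanish:
  `kerSum = 0` for `#ker ≠ 2`).  The blocks with `r₄(Pic 𝒪₄) = 1` but `g(d)` even (LEAD g9's census: 576 of 2010 blocks) are now covered.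
BSD is not proved by any of this; no class is closed by this file.

References: [cite: TianYuanZhang2017, §3.1 (p0011 L1–L13, L53–L64), Prop. 3.2 (2) (p0010 L111–L113), Thm. 3.6 (2), proof of Lemma 3.21 (p0020 L50–L63)];
[cite: Cox2013, §7.D Thm. 7.24, §9.A (pp. 180–181), §5.C Lemma 5.19, (5.22), Cor. 5.25, §3.B Thm. 3.15];
[cite: Rotman1995, Thm. 2.19 (PDF p. 37)]; [cite: Stevenhagen1995RedeiMatrices, §2]; crux workfile `Lines/offtyz_v7_EvenTwoPrimes.md` §5, §11.
-/

noncomputable section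

open scoped Classical NumberField

open WeierstrassCurve WeierstrassCurve.Affine Finset Matrix Literature.NumberTheory.EllipticCurves
  Literature.NumberTheory.EllipticCurves.TianYuanZhang2017
  Literature.NumberTheory.EllipticCurves.TianYuanZhang2017.W2
  Literature.NumberTheory.EllipticCurves.HeathBrown1994
  Literature.NumberTheory.EllipticCurves.HeathBrown1994.Families
  Literature.NumberTheory.EllipticCurves.Smith2016
  Literature.NumberTheory.QuadraticFields.RingClass
  Literature.NumberTheory.QuadraticFields
  Summit.BirchSwinnertonDyer.Rank1Residual.P2.GenusPeriodTransferLayer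
  Summit.BirchSwinnertonDyer.PrintCf2.QForm

set_option autoImplicit false

namespace Summit.BirchSwinnertonDyer.PrintCf2.MoverAssembly

variable {n : ℕ} (D : GenusPointData n)
variable {m : ℕ} (q : Fin m → ℕ) (hq : ∀ j, (q j).Prime) (hqodd : ∀ j, Odd (q j)) (hqinj : Function.Injective q)
variable {d : ℕ} {z : APoint D.H} {Φ : Finset (D.H ≃ₐ[ℚ] D.H)} {ΓH ΓH' : Subgroup (D.H ≃ₐ[ℚ] D.H)} {σ c : D.H ≃ₐ[ℚ] D.H}
variable {G : Type*} [CommGroup G] {ρ : D.galK d →* G}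

/-! ## §1 CASE A (`#ker N_d = 2`): `χ_d` takes the value `1` -/

include hq hqodd hqinj in
/-- **CASE A.**  `#ker N_d = 2` (the Frobenius rows are independent) ⟹ some `a ∈ Gal(ℍ′_n/K_d)` has `χ_d(a) = 1`, i.e. `(a·a)^{g(d)} ≡ σ`
modulo `Gal(ℍ′_n/H′_d)` — with NO parity hypothesis on `g(d)`: by `isSquare_invol_eq_one_or` the involution `ρ(σ)` is the unique involution of
`G²` (order `2g(d)`, `natCard_isSquare_eq`), and `FourRankOne.exists_pow_eq_of_forall_sq_eq_one` gives `y ∈ G²` with `y^{g(d)} = ρ(σ)`.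
[cite: TianYuanZhang2017, §3.1 (p0011 L1–L13), Prop. 3.2 (2), proof of Lemma 3.21 (p0020 L55–L62)] [cite: Rotman1995, Thm. 2.19 (PDF p. 37)]
[cite: Cox2013, §3.B Thm. 3.15, §9.A] -/
theorem exists_sqChi_of_card_ker_eq_two [Finite G] (hn : Squarefree n) (hd : d ∈ n.divisors) (hd1 : 1 < d)
    (hprod : 2 * ∏ j, q j = d) (h : D.CMBlockSpec d z Φ ΓH ΓH' σ c)
    (hρ1 : Function.Surjective ρ) (hρ2 : ∀ g : D.galK d, ρ g = 1 ↔ (g : D.H ≃ₐ[ℚ] D.H) ∈ ΓH')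
    (hρ3 : ∀ g : D.galK d, D.TrivialOnL d g ↔ ∃ h : D.galK d, (h : D.H ≃ₐ[ℚ] D.H) D.im = D.im ∧ ρ g = ρ h * ρ h)
    {θ : D.H ≃ₐ[ℚ] D.H} (hθd : θ (D.sqrtNeg d) = D.sqrtNeg d) (hθ : θ * θ * σ⁻¹ ∈ ΓH')
    (φ : Fin m → D.galK d)
    (hφ : ∀ j, (φ j : D.H ≃ₐ[ℚ] D.H) * (φ j : D.H ≃ₐ[ℚ] D.H) ∈ ΓH' ∧
      (φ j : D.H ≃ₐ[ℚ] D.H) D.im = (jacobiSym (-1) (q j)) • D.im ∧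
      (φ j : D.H ≃ₐ[ℚ] D.H) (D.sqrtNeg 2) = (jacobiSym (-2) (q j)) • D.sqrtNeg 2 ∧
      ∀ i, i ≠ j → (φ j : D.H ≃ₐ[ℚ] D.H) (D.sqrtNeg (q i)) = (jacobiSym (-(q i : ℤ)) (q j)) • D.sqrtNeg (q i))
    (hcard : Fintype.card {v : Fin m ⊕ Unit → ZMod 2 //
      (Matrix.fromBlocks (legendreMatrix q + legendreDiagonal q (-2)) (Matrix.of fun j (_ : Unit) => addLegendreSym 2 (q j))
        (0 : Matrix Unit (Fin m) (ZMod 2)) (0 : Matrix Unit Unit (ZMod 2))) *ᵥ v = 0} = 2) :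
    ∃ a : D.galK d, ((a : D.H ≃ₐ[ℚ] D.H) * a) ^ gK d * σ⁻¹ ∈ ΓH' := by
  have hNrow : ∀ u, (Matrix.fromBlocks (legendreMatrix q + legendreDiagonal q (-2)) (Matrix.of fun j (_ : Unit) => addLegendreSym 2 (q j))
      (0 : Matrix Unit (Fin m) (ZMod 2)) (0 : Matrix Unit Unit (ZMod 2))) (Sum.inr u) = 0 := fun u => by
    funext cc; rcases cc with i | u'
    · simp only [Matrix.fromBlocks_apply₂₁, Matrix.zero_apply, Pi.zero_apply]
    · simp only [Matrix.fromBlocks_apply₂₂, Matrix.zero_apply, Pi.zero_apply]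
  obtain ⟨B, hB⟩ := exists_bitsHom_six D q hq hqodd hqinj hn hd hprod hρ1 hρ3
  obtain ⟨hBker, -⟩ := bitsHom_six_ker_range D q hq hqodd hqinj hn hd hprod hρ1 hρ3 hB
  obtain ⟨hκ1, hκκ⟩ := rho_sigma_ne_one_and_mul_self D h hρ2
  have hκsq : IsSquare (ρ ⟨σ, D.sigma_mem_galK_of_cmBlockSpec h⟩) := isSquare_rho_sigma D h hρ2 hθd hθ
  have hBκ : B (ρ ⟨σ, D.sigma_mem_galK_of_cmBlockSpec h⟩) = 1 := (hBker _).mpr hκsq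
  have hff : ∀ j, ρ (φ j) * ρ (φ j) = 1 := fun j => by rw [← map_mul, hρ2]; exact (hφ j).1
  have hBf : ∀ j, B (ρ (φ j)) = Multiplicative.ofAdd
      ((Matrix.fromBlocks (legendreMatrix q + legendreDiagonal q (-2)) (Matrix.of fun j (_ : Unit) => addLegendreSym 2 (q j))
        (0 : Matrix Unit (Fin m) (ZMod 2)) (0 : Matrix Unit Unit (ZMod 2))) (Sum.inl j)) := by
    intro j
    rw [hB]
    exact congrArg _ (funext fun cc => bits_eq_row_of_frobenius_six D q hq hqodd hqinj hd hprod j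
      ((D.mem_galK_iff d _).mp (φ j).2) (hφ j).2.1 (hφ j).2.2.1 (hφ j).2.2.2 cc)
  have hG2 := natCard_mul_self_eq_one D q hq hqodd hqinj hn hd hprod hρ1 hρ3
  have hT2 : ∀ s : G, IsSquare s → s * s = 1 → s = 1 ∨ s = ρ ⟨σ, D.sigma_mem_galK_of_cmBlockSpec h⟩ :=
    isSquare_invol_eq_one_or B hBker _ hNrow hcard hκ1 hκκ hBκ hff hBf hG2
  -- FourRankOne on `T = G²`
  set T := (powMonoidHom (α := G) 2).range with hT
  have hTmem : ∀ y, y ∈ T ↔ IsSquare y := fun y => by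
    constructor
    · rintro ⟨w, rfl⟩; exact ⟨w, by rw [powMonoidHom_apply, pow_two]⟩
    · rintro ⟨w, hw⟩; exact ⟨w, by rw [powMonoidHom_apply, pow_two, hw]⟩
  have hTcard : Nat.card T = 2 * gK d := by
    rw [← natCard_isSquare_eq D q hq hqodd hqinj hn hd hd1 hprod h hρ1 hρ2 hρ3 hθd hθ]
    exact Nat.card_congr (Equiv.subtypeEquivRight fun y => hTmem y)
  have hκT : ρ ⟨σ, D.sigma_mem_galK_of_cmBlockSpec h⟩ ∈ T := (hTmem _).mpr hκsq
  have hκ1' : (⟨_, hκT⟩ : T) ≠ 1 := fun e1 => hκ1 (congrArg Subtype.val e1 :)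
  have hκ2' : (⟨_, hκT⟩ : T) ^ 2 = 1 := Subtype.ext (by rw [Subgroup.coe_pow, pow_two]; exact hκκ)
  have huniq : ∀ s : T, s ^ 2 = 1 → s = 1 ∨ s = ⟨_, hκT⟩ := by
    intro s hs
    have hs' : (s : G) * s = 1 := by
      have := congrArg Subtype.val hs
      rwa [Subgroup.coe_pow, pow_two] at this
    rcases hT2 s ((hTmem s).mp s.2) hs' with h1 | h1
    · exact Or.inl (Subtype.ext h1)
    · exact Or.inr (Subtype.ext h1)
  obtain ⟨x, hx⟩ := Literature.NumberTheory.QuadraticFields.FourRankOne.exists_pow_eq_of_forall_sq_eq_one (gK d) T hTcard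
    ⟨_, hκT⟩ hκ1' hκ2' huniq
  obtain ⟨w, hw⟩ := x.2
  obtain ⟨b, rfl⟩ := hρ1 w
  refine ⟨b, (sqChi_mem_iff_pow_rho_eq D hρ2 (D.sigma_mem_galK_of_cmBlockSpec h) b).mpr ?_⟩
  have hxval : (x : G) ^ gK d = ρ ⟨σ, D.sigma_mem_galK_of_cmBlockSpec h⟩ := congrArg Subtype.val hx
  rw [powMonoidHom_apply] at hw
  rw [pow_mul, hw, hxval]

/-! ## §2 CASE B (`#ker N_d ≠ 2`): a square involution `∏_{j∈U} ρ(φ_j) ∉ {1, ρ(σ)}` kills `χ_d` (the transfer lemma in `G`) -/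

include hq hqodd hqinj in
/-- **CASE B.**  If the Frobenius rows are dependent (`#ker N_d ≠ 2`) and the non-trivial products `∏_{j∈U} ρ(φ_j)` avoid `1` and `ρ(σ)` (hypothesis
`hval`; for `Pic(𝒪₄)`: `∏_{j∈U}[𝔭_{q_j}] ≠ 1` in `Cl(𝒪_{K_d})` by the class values (F4)), then `χ_d(a) = 0` for EVERY `a ∈ Gal(ℍ′_n/K_d)`: a relation
`Σ_{j∈U} N_j = 0` makes `e = ∏_{j∈U} ρ(φ_j)` a square (zero bits) involution `≠ 1, ρ(σ)` of `G²`, and an element `y = ρ(a)²` with `y^{g(d)} = ρ(σ)`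
would make `ρ(σ)` the only involution of `G²` (`FourRankOne.eq_one_or_eq_of_pow_eq`, `#G² = 2g(d)`).
[cite: TianYuanZhang2017, §3.1 (p0011 L1–L13), Prop. 3.2 (2), proof of Lemma 3.21 (p0020 L55–L62)] [cite: Rotman1995, Thm. 2.19 (PDF p. 37)]
[cite: Cox2013, §5.C Cor. 5.25, §9.A] -/
theorem sqChi_not_mem_of_card_ker_ne_two [Finite G] (hn : Squarefree n) (hd : d ∈ n.divisors) (hd1 : 1 < d)
    (hprod : 2 * ∏ j, q j = d) (h : D.CMBlockSpec d z Φ ΓH ΓH' σ c)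
    (hρ1 : Function.Surjective ρ) (hρ2 : ∀ g : D.galK d, ρ g = 1 ↔ (g : D.H ≃ₐ[ℚ] D.H) ∈ ΓH')
    (hρ3 : ∀ g : D.galK d, D.TrivialOnL d g ↔ ∃ h : D.galK d, (h : D.H ≃ₐ[ℚ] D.H) D.im = D.im ∧ ρ g = ρ h * ρ h)
    {θ : D.H ≃ₐ[ℚ] D.H} (hθd : θ (D.sqrtNeg d) = D.sqrtNeg d) (hθ : θ * θ * σ⁻¹ ∈ ΓH')
    (φ : Fin m → D.galK d)
    (hφ : ∀ j, (φ j : D.H ≃ₐ[ℚ] D.H) * (φ j : D.H ≃ₐ[ℚ] D.H) ∈ ΓH' ∧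
      (φ j : D.H ≃ₐ[ℚ] D.H) D.im = (jacobiSym (-1) (q j)) • D.im ∧
      (φ j : D.H ≃ₐ[ℚ] D.H) (D.sqrtNeg 2) = (jacobiSym (-2) (q j)) • D.sqrtNeg 2 ∧
      ∀ i, i ≠ j → (φ j : D.H ≃ₐ[ℚ] D.H) (D.sqrtNeg (q i)) = (jacobiSym (-(q i : ℤ)) (q j)) • D.sqrtNeg (q i))
    (hval : ∀ w : Fin m → ZMod 2, w ≠ 0 →
      (∏ j, (if w j = 1 then ρ (φ j) else 1)) ≠ 1 ∧ (∏ j, (if w j = 1 then ρ (φ j) else 1)) ≠ ρ ⟨σ, D.sigma_mem_galK_of_cmBlockSpec h⟩)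
    (hcard : Fintype.card {v : Fin m ⊕ Unit → ZMod 2 //
      (Matrix.fromBlocks (legendreMatrix q + legendreDiagonal q (-2)) (Matrix.of fun j (_ : Unit) => addLegendreSym 2 (q j))
        (0 : Matrix Unit (Fin m) (ZMod 2)) (0 : Matrix Unit Unit (ZMod 2))) *ᵥ v = 0} ≠ 2)
    (a : D.galK d) : ((a : D.H ≃ₐ[ℚ] D.H) * a) ^ gK d * σ⁻¹ ∉ ΓH' := by
  intro hχ
  have hNrow : ∀ u, (Matrix.fromBlocks (legendreMatrix q + legendreDiagonal q (-2)) (Matrix.of fun j (_ : Unit) => addLegendreSym 2 (q j))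
      (0 : Matrix Unit (Fin m) (ZMod 2)) (0 : Matrix Unit Unit (ZMod 2))) (Sum.inr u) = 0 := fun u => by
    funext cc; rcases cc with i | u'
    · simp only [Matrix.fromBlocks_apply₂₁, Matrix.zero_apply, Pi.zero_apply]
    · simp only [Matrix.fromBlocks_apply₂₂, Matrix.zero_apply, Pi.zero_apply]
  obtain ⟨B, hB⟩ := exists_bitsHom_six D q hq hqodd hqinj hn hd hprod hρ1 hρ3
  obtain ⟨hBker, -⟩ := bitsHom_six_ker_range D q hq hqodd hqinj hn hd hprod hρ1 hρ3 hB
  obtain ⟨hκ1, hκκ⟩ := rho_sigma_ne_one_and_mul_self D h hρ2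
  have hκsq : IsSquare (ρ ⟨σ, D.sigma_mem_galK_of_cmBlockSpec h⟩) := isSquare_rho_sigma D h hρ2 hθd hθ
  have hBκ : B (ρ ⟨σ, D.sigma_mem_galK_of_cmBlockSpec h⟩) = 1 := (hBker _).mpr hκsq
  have hff : ∀ j, ρ (φ j) * ρ (φ j) = 1 := fun j => by rw [← map_mul, hρ2]; exact (hφ j).1
  have hBf : ∀ j, B (ρ (φ j)) = Multiplicative.ofAdd
      ((Matrix.fromBlocks (legendreMatrix q + legendreDiagonal q (-2)) (Matrix.of fun j (_ : Unit) => addLegendreSym 2 (q j))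
        (0 : Matrix Unit (Fin m) (ZMod 2)) (0 : Matrix Unit Unit (ZMod 2))) (Sum.inl j)) := by
    intro j
    rw [hB]
    exact congrArg _ (funext fun cc => bits_eq_row_of_frobenius_six D q hq hqodd hqinj hd hprod j
      ((D.mem_galK_iff d _).mp (φ j).2) (hφ j).2.1 (hφ j).2.2.1 (hφ j).2.2.2 cc)
  -- a relation among the rows and the square involution `e`
  obtain ⟨w, hw0, hw⟩ := exists_sum_smul_row_eq_zero _ hNrow hcard
  obtain ⟨he1, heκ⟩ := hval w hw0
  have hBe : B (∏ j, (if w j = 1 then ρ (φ j) else 1)) = 1 := by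
    have := map_invol_prod_eq B _ hBκ hBf (Sum.elim w (fun _ => 0))
    simp only [Sum.elim_inl, Sum.elim_inr] at this
    rw [if_neg (by decide), one_mul, hw, ofAdd_zero] at this
    exact this
  have hesq : IsSquare (∏ j, (if w j = 1 then ρ (φ j) else 1)) := (hBker _).mp hBe
  have hee : (∏ j, (if w j = 1 then ρ (φ j) else 1)) * (∏ j, (if w j = 1 then ρ (φ j) else 1)) = 1 := by
    rw [← Finset.prod_mul_distrib]
    exact Finset.prod_eq_one fun j _ => by
      split_ifs
      · exact hff j
      · exact mul_one 1
  -- FourRankOne on `T = G²`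
  set T := (powMonoidHom (α := G) 2).range with hT
  have hTmem : ∀ y, y ∈ T ↔ IsSquare y := fun y => by
    constructor
    · rintro ⟨w', rfl⟩; exact ⟨w', by rw [powMonoidHom_apply, pow_two]⟩
    · rintro ⟨w', hw'⟩; exact ⟨w', by rw [powMonoidHom_apply, pow_two, hw']⟩
  have hTcard : Nat.card T = 2 * gK d := by
    rw [← natCard_isSquare_eq D q hq hqodd hqinj hn hd hd1 hprod h hρ1 hρ2 hρ3 hθd hθ]
    exact Nat.card_congr (Equiv.subtypeEquivRight fun y => hTmem y)
  have hκT : ρ ⟨σ, D.sigma_mem_galK_of_cmBlockSpec h⟩ ∈ T := (hTmem _).mpr hκsq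
  have hκ1' : (⟨_, hκT⟩ : T) ≠ 1 := fun e1 => hκ1 (congrArg Subtype.val e1 :)
  have hκ2' : (⟨_, hκT⟩ : T) ^ 2 = 1 := Subtype.ext (by rw [Subgroup.coe_pow, pow_two]; exact hκκ)
  have hyT : (ρ a) ^ 2 ∈ T := ⟨ρ a, by rw [powMonoidHom_apply]⟩
  have hy : (⟨(ρ a) ^ 2, hyT⟩ : T) ^ gK d = ⟨_, hκT⟩ := Subtype.ext (by
    rw [Subgroup.coe_pow, ← pow_mul]
    exact (sqChi_mem_iff_pow_rho_eq D hρ2 (D.sigma_mem_galK_of_cmBlockSpec h) a).mp hχ)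
  have heT : (∏ j, (if w j = 1 then ρ (φ j) else 1)) ∈ T := (hTmem _).mpr hesq
  have he2 : (⟨_, heT⟩ : T) ^ 2 = 1 := Subtype.ext (by rw [Subgroup.coe_pow, pow_two]; exact hee)
  rcases Literature.NumberTheory.QuadraticFields.FourRankOne.eq_one_or_eq_of_pow_eq (S := T) hTcard hκ1' hκ2' hy ⟨_, heT⟩ he2
    with h1 | h1
  · exact he1 (congrArg Subtype.val h1 :)
  · exact heκ (congrArg Subtype.val h1 :)

/-! ## §3 THE REGIME-FREE BLOCK FORM -/

include hq hqodd hqinj in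
/-- **THE BLOCK FORM ON A BLOCK `d ≡ 6 (mod 8)`, ALL REGIMES.**  For a block `d = 2·q₁⋯q_m` of a square-free `n` with its CM-point display
(`CMBlockSpec`), the lift `θ` of `σ_{1+ϖ}` (`θθσ⁻¹ ∈ Gal(ℍ′_n/H′_d)`), a ring class dictionary `ρ` onto a finite abelian group ((RC1)–(RC3)), the
conductor-`4` Frobenius elements `φ_j` of the `q_j` ((F1)–(F3)) whose non-trivial products avoid `1, ρ(σ)` in the target group (hypothesis `hval`,
(F4)-type), and EVERY `g ∈ Gal(ℍ′_n/K_d)`: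
`[(g·g)^{g(d)}·σ⁻¹ ∈ Gal(ℍ′_n/H′_d)] = Σ_c (kerSum N_d)_c · x_c(g)`, `x(g) = ([g moves i√−q_i])_i ; [g moves i√−2])`, `N_d = [[A_d + D₋₂, z_d],[0,0]]` —
g8's `sqMotion_eq_kerSum_dotProduct_bits_six` WITHOUT `Odd (gK d)` and WITHOUT `#ker N_d = 2`.  Case `#ker N_d = 2`: `χ_d` factors through the bits,
the induced additive map kills the rows of `N_d`, hence is `0` or `kerSum N_d ·`, and it is non-zero by `exists_sqChi_of_card_ker_eq_two`; case
`#ker N_d ≠ 2`: `kerSum N_d = 0` and `χ_d ≡ 0` by `sqChi_not_mem_of_card_ker_ne_two`.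
[cite: TianYuanZhang2017, §3.1 (p0011 L1–L13, L53–L64), Prop. 3.2 (2), Thm. 3.6 (2), proof of Lemma 3.21 (p0020 L50–L63)]
[cite: Cox2013, §5.C Lemma 5.19, (5.22), Cor. 5.25, §9.A] [cite: Rotman1995, Thm. 2.19 (PDF p. 37)] -/
theorem sqMotion_eq_kerSum_dotProduct_bits_six_all [Finite G] (hn : Squarefree n) (hd : d ∈ n.divisors) (hd8 : d % 8 = 6)
    (hprod : 2 * ∏ j, q j = d) (h : D.CMBlockSpec d z Φ ΓH ΓH' σ c)
    (hρ1 : Function.Surjective ρ) (hρ2 : ∀ g : D.galK d, ρ g = 1 ↔ (g : D.H ≃ₐ[ℚ] D.H) ∈ ΓH')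
    (hρ3 : ∀ g : D.galK d, D.TrivialOnL d g ↔ ∃ h : D.galK d, (h : D.H ≃ₐ[ℚ] D.H) D.im = D.im ∧ ρ g = ρ h * ρ h)
    {θ : D.H ≃ₐ[ℚ] D.H} (hθd : θ (D.sqrtNeg d) = D.sqrtNeg d) (hθ : θ * θ * σ⁻¹ ∈ ΓH')
    (φ : Fin m → D.galK d)
    (hφ : ∀ j, (φ j : D.H ≃ₐ[ℚ] D.H) * (φ j : D.H ≃ₐ[ℚ] D.H) ∈ ΓH' ∧
      (φ j : D.H ≃ₐ[ℚ] D.H) D.im = (jacobiSym (-1) (q j)) • D.im ∧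
      (φ j : D.H ≃ₐ[ℚ] D.H) (D.sqrtNeg 2) = (jacobiSym (-2) (q j)) • D.sqrtNeg 2 ∧
      ∀ i, i ≠ j → (φ j : D.H ≃ₐ[ℚ] D.H) (D.sqrtNeg (q i)) = (jacobiSym (-(q i : ℤ)) (q j)) • D.sqrtNeg (q i))
    (hval : ∀ w : Fin m → ZMod 2, w ≠ 0 →
      (∏ j, (if w j = 1 then ρ (φ j) else 1)) ≠ 1 ∧ (∏ j, (if w j = 1 then ρ (φ j) else 1)) ≠ ρ ⟨σ, D.sigma_mem_galK_of_cmBlockSpec h⟩)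
    (g : D.H ≃ₐ[ℚ] D.H) (hg : g (D.sqrtNeg d) = D.sqrtNeg d) :
    (if (g * g) ^ gK d * σ⁻¹ ∈ ΓH' then (1 : ZMod 2) else 0) =
      ∑ c, kerSum (Matrix.fromBlocks (legendreMatrix q + legendreDiagonal q (-2)) (Matrix.of fun j (_ : Unit) => addLegendreSym 2 (q j))
          (0 : Matrix Unit (Fin m) (ZMod 2)) (0 : Matrix Unit Unit (ZMod 2))) c *
        Sum.elim (fun i => if g (D.im * D.sqrtNeg (q i)) = D.im * D.sqrtNeg (q i) then (0 : ZMod 2) else 1)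
          (fun (_ : Unit) => if g (D.im * D.sqrtNeg 2) = D.im * D.sqrtNeg 2 then (0 : ZMod 2) else 1) c := by
  have hd1 : 1 < d := by omega
  have hq2 : ∀ j, q j ≠ 2 := fun j h2 => by
    have := hqodd j; rw [h2] at this; exact (Nat.not_odd_iff_even.mpr even_two) this
  set N := Matrix.fromBlocks (legendreMatrix q + legendreDiagonal q (-2)) (Matrix.of fun j (_ : Unit) => addLegendreSym 2 (q j))
    (0 : Matrix Unit (Fin m) (ZMod 2)) (0 : Matrix Unit Unit (ZMod 2)) with hN
  by_cases hcard : Fintype.card {v : Fin m ⊕ Unit → ZMod 2 // N *ᵥ v = 0} = 2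
  · -- CASE A: `χ` factors through the bits, the induced additive map kills the rows, is `0` or `kerSum ·`, and is non-zero
    set χ : D.galK d → ZMod 2 := fun a => if ((a : D.H ≃ₐ[ℚ] D.H) * a) ^ gK d * σ⁻¹ ∈ ΓH' then 1 else 0 with hχ
    set x : D.galK d → (Fin m ⊕ Unit → ZMod 2) := fun a =>
      Sum.elim (fun i => if (a : D.H ≃ₐ[ℚ] D.H) (D.im * D.sqrtNeg (q i)) = D.im * D.sqrtNeg (q i) then (0 : ZMod 2) else 1)
        (fun (_ : Unit) => if (a : D.H ≃ₐ[ℚ] D.H) (D.im * D.sqrtNeg 2) = D.im * D.sqrtNeg 2 then (0 : ZMod 2) else 1) with hx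
    have hχmul : ∀ a b, χ (a * b) = χ a + χ b := fun a b => chi_mul_of_cmBlockSpec D hd hd1 h a.2 b.2
    have hxmul : ∀ a b, x (a * b) = x a + x b := fun a b => bits_six_mul D q hd hprod a b
    have hχx0 : ∀ a, x a = 0 → χ a = 0 := by
      intro a ha
      have hL : D.TrivialOnL d a := (bits_six_eq_zero_iff_trivialOnL D q hq hqodd hqinj hn hd hprod a).mp ha
      simp only [hχ, if_neg (chi_eq_zero_of_trivialOnL_of_cmBlockSpec D hd1 h hL)]
    have hχx : ∀ a b, x a = x b → χ a = χ b := by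
      intro a b hab
      have h0 : x (a⁻¹ * b) = 0 := by
        have e := hxmul a (a⁻¹ * b)
        rw [mul_inv_cancel_left, ← hab] at e
        have : x a + x (a⁻¹ * b) = x a + 0 := by rw [add_zero]; exact e.symm
        exact add_left_cancel this
      have e := hχmul a (a⁻¹ * b)
      rw [mul_inv_cancel_left, hχx0 _ h0, add_zero] at e
      exact e.symm
    have hsurj : ∀ v : Fin m ⊕ Unit → ZMod 2, ∃ a : D.galK d, x a = v := fun v =>
      exists_galK_bits_six_eq D q hq hqinj hd hprod hq2 v
    choose lift hlift using hsurj
    have hone_triv : χ 1 = 0 := by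
      simp only [hχ]
      rw [if_neg]
      exact chi_eq_zero_of_trivialOnL_of_cmBlockSpec D hd1 h (trivialOnL_one D d)
    let δ : (Fin m ⊕ Unit → ZMod 2) →+ ZMod 2 :=
      { toFun := fun v => χ (lift v)
        map_zero' := by
          show χ (lift 0) = 0
          rw [hχx (lift 0) 1 (by
            rw [hlift]; funext cc; rcases cc with i | u
            · simp only [hx, Sum.elim_inl, Pi.zero_apply, OneMemClass.coe_one, AlgEquiv.one_apply, if_true]
            · simp only [hx, Sum.elim_inr, Pi.zero_apply, OneMemClass.coe_one, AlgEquiv.one_apply, if_true])]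
          exact hone_triv
        map_add' := fun v w => by
          show χ (lift (v + w)) = χ (lift v) + χ (lift w)
          rw [← hχmul, hχx (lift (v + w)) (lift v * lift w) (by rw [hxmul, hlift, hlift, hlift])] }
    have hδ : ∀ a, χ a = δ (x a) := fun a => hχx a (lift (x a)) (by rw [hlift])
    -- `δ` kills the rows of `N`
    have hrows : ∀ r, δ (N r) = 0 := by
      intro r
      rcases r with j | u
      · have hxφ : x (φ j) = N (Sum.inl j) :=
          funext fun cc => bits_eq_row_of_frobenius_six D q hq hqodd hqinj hd hprod j
            ((D.mem_galK_iff d _).mp (φ j).2) (hφ j).2.1 (hφ j).2.2.1 (hφ j).2.2.2 cc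
        rw [← hxφ, ← hδ]
        simp only [hχ]
        rw [if_neg (chi_eq_zero_of_mul_self_mem_of_cmBlockSpec D h (hφ j).1)]
      · have hrow0 : N (Sum.inr u) = 0 := by
          funext cc; rcases cc with i | u'
          · simp only [hN, Matrix.fromBlocks_apply₂₁, Matrix.zero_apply, Pi.zero_apply]
          · simp only [hN, Matrix.fromBlocks_apply₂₂, Matrix.zero_apply, Pi.zero_apply]
        rw [hrow0, map_zero]
    -- `δ ≠ 0`
    obtain ⟨a₁, ha₁⟩ := exists_sqChi_of_card_ker_eq_two D q hq hqodd hqinj hn hd hd1 hprod h hρ1 hρ2 hρ3 hθd hθ φ hφ hcard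
    have hχa₁ : χ a₁ = 1 := by simp only [hχ]; rw [if_pos ha₁]
    -- conclude
    change χ ⟨g, hg⟩ = ∑ cc, kerSum N cc * x ⟨g, hg⟩ cc
    obtain ⟨-, hker⟩ := ker_iff_of_card_eq_two N hcard
    rcases addMonoidHom_eq_zero_or_eq_dotProduct' N hker δ hrows with hzero | hdot
    · exfalso
      rw [hδ, hzero] at hχa₁
      exact zero_ne_one hχa₁
    · rw [hδ, hdot, dotProduct]
  · -- CASE B: both sides vanish
    rw [kerSum_eq_zero_of_card_ne_two N hcard]
    simp only [Pi.zero_apply, zero_mul, Finset.sum_const_zero]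
    rw [if_neg]
    exact sqChi_not_mem_of_card_ker_ne_two D q hq hqodd hqinj hn hd hd1 hprod h hρ1 hρ2 hρ3 hθd hθ φ hφ hval hcard ⟨g, hg⟩

end Summit.BirchSwinnertonDyer.PrintCf2.MoverAssembly

end
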